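import Mathlib
import Summits.MatrixMultiplication.MatrixMultiplication.Theorems.SoloBlindTriangleDoubled

/-!
# Solo-blind seat (MatrixMultiplication), s66 — Conjecture T△ for `2d + 1` triangles, sharp form
(SHARPEST §2T, TRIANGLE.md (R15), CLAIMS c626)

Setting of `SoloBlindTriangleDoubled.lean` (a good = rainbow-zero-sum-free family of `d` zero-sum triangles
each used twice) plus ONE further zero-sum triangle `{a', b', c'}` used once (a "simple" triangle).

* `soloBlind_triangleDoubled_add_simple_injective` — the map `(e, x) ↦ Σ_i E_i(e_i) + E'(x)` with
  `E_i = {0, a_i, -b_i}` and `E' = {0, a', -b'}` is injective on `3^d × 3` points.  Proof: a coincidence gives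
  `Σ_i (E_i e_i - E_i ẽ_i) + (E' x - E' x̃) = 0`; the last difference is `±` an element of the simple triangle
  (signed table `soloBlindTriRep3`), the pair differences are realisable with either sign (table
  `soloBlindTriRep` of the doubled file), so after multiplying by the sign one gets a non-empty rainbow zero-sum.
* `soloBlind_triangleDoubled_add_simple_card` — hence `|H| ≥ 3^(d+1) = 3^((n+1)/2)` for such a family of
  `n = 2d+1` triangles: Conjecture T△ (`|H| ≥ 3^(n/2)`) with a factor `√3` to spare, and SHARP — it matches the
  exhaustive thresholds `9, 27, 81` and "no `(4,1)`-family in `ℤ/m` for `m ≤ 192 < 243`" (TRIANGLE.md (R14)).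
No `ω` content by itself (door I1⁗ bookkeeping).
-/

namespace Summit.MatrixMultiplication.MatrixMultiplication.Theorems

open Finset BigOperators

section TriangleSimpleOne

variable {H : Type*} [AddCommGroup H] {d : ℕ}

/-- Packing set of one simple triangle: `E' = {0, a', -b'}` as a map `Fin 3 → H`. -/
def soloBlindTriE1 (a' b' : H) (x : Fin 3) : H :=
  ![0, a', -b'] x

/-- Signed realisation table: `E' x - E' y` equals `+` (flag `true`) or `-` (flag `false`) the value of the
recorded selection (`none` = empty, `some k` = the `k`-th element of the triangle). -/
def soloBlindTriRep3 (x y : Fin 3) : Option (Fin 3) × Bool :=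
  ![![((none : Option (Fin 3)), true), (some 0, false), (some 1, true)],
    ![(some 0, true), (none, true), (some 2, false)],
    ![(some 1, false), (some 2, true), (none, true)]] x y

/-- Correctness of the signed table (uses only `a' + b' + c' = 0`). -/
theorem soloBlind_triRep3_val (a' b' c' : H) (hsum1 : a' + b' + c' = 0) (x y : Fin 3) :
    (if (soloBlindTriRep3 x y).2 then ((soloBlindTriRep3 x y).1).elim 0 ![a', b', c']
      else -(((soloBlindTriRep3 x y).1).elim 0 ![a', b', c']))
      = soloBlindTriE1 a' b' x - soloBlindTriE1 a' b' y := by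
  have hc : c' = -a' - b' := by
    have h : c' = -(a' + b') := eq_neg_of_add_eq_zero_right hsum1
    rw [h]; abel
  fin_cases x <;> fin_cases y <;> (simp [soloBlindTriRep3, soloBlindTriE1, hc]; try abel)

omit [AddCommGroup H] in
/-- The signed table records the empty selection only on the diagonal. -/
theorem soloBlind_triRep3_eq_of_none (x y : Fin 3) (h : (soloBlindTriRep3 x y).1 = none) : x = y := by
  fin_cases x <;> fin_cases y <;> simp_all [soloBlindTriRep3]

/-- **Injectivity for `d` doubled pairs plus one simple triangle.**  If the family "triangles `i < d` twice,
triangle `{a', b', c'}` once" is good, then `(e, x) ↦ Σ_i E_i(e_i) + E'(x)` is injective. -/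
theorem soloBlind_triangleDoubled_add_simple_injective (a b c : Fin d → H)
    (hsum : ∀ i, a i + b i + c i = 0) (a' b' c' : H) (hsum1 : a' + b' + c' = 0)
    (hgood1 : ∀ (s t : Fin d → Option (Fin 3)) (o : Option (Fin 3)),
      (∑ i, (soloBlindTriVal a b c i (s i) + soloBlindTriVal a b c i (t i))) + o.elim 0 ![a', b', c'] = 0 →
        (∀ i, s i = none ∧ t i = none) ∧ o = none) :
    Function.Injective (fun p : (Fin d → Fin 3) × Fin 3 =>
      (∑ i, soloBlindTriE a b i (p.1 i)) + soloBlindTriE1 a' b' p.2) := by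
  rintro ⟨f, x⟩ ⟨g, y⟩ hfg
  have hfg' : (∑ i, soloBlindTriE a b i (f i)) + soloBlindTriE1 a' b' x
      = (∑ i, soloBlindTriE a b i (g i)) + soloBlindTriE1 a' b' y := hfg
  have hdiff : (∑ i, (soloBlindTriE a b i (f i) - soloBlindTriE a b i (g i)))
      + (soloBlindTriE1 a' b' x - soloBlindTriE1 a' b' y) = 0 := by
    rw [Finset.sum_sub_distrib]
    have h0 := sub_eq_zero.mpr hfg'
    calc (∑ i, soloBlindTriE a b i (f i)) - (∑ i, soloBlindTriE a b i (g i))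
          + (soloBlindTriE1 a' b' x - soloBlindTriE1 a' b' y)
        = (∑ i, soloBlindTriE a b i (f i)) + soloBlindTriE1 a' b' x
          - ((∑ i, soloBlindTriE a b i (g i)) + soloBlindTriE1 a' b' y) := by abel
      _ = 0 := h0
  have hrep3 := soloBlind_triRep3_val a' b' c' hsum1 x y
  cases hb : (soloBlindTriRep3 x y).2 with
  | true =>
    simp only [hb, if_true] at hrep3
    have key := hgood1 (fun i => (soloBlindTriRep (f i) (g i)).1)
      (fun i => (soloBlindTriRep (f i) (g i)).2) (soloBlindTriRep3 x y).1 (by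
        simp only [soloBlind_triRep_val a b c hsum]
        rw [hrep3]; exact hdiff)
    have hf : f = g :=
      funext fun i => soloBlind_triRep_eq_of_none (f i) (g i) (key.1 i).1 (key.1 i).2
    have hx : x = y := soloBlind_triRep3_eq_of_none x y key.2
    subst hf; subst hx; rfl
  | false =>
    simp only [hb, Bool.false_eq_true, if_false] at hrep3
    have hval : ((soloBlindTriRep3 x y).1).elim 0 ![a', b', c']
        = -(soloBlindTriE1 a' b' x - soloBlindTriE1 a' b' y) := by
      rw [← hrep3, neg_neg]
    have hneg : (∑ i, (soloBlindTriE a b i (g i) - soloBlindTriE a b i (f i)))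
        = -(∑ i, (soloBlindTriE a b i (f i) - soloBlindTriE a b i (g i))) := by
      rw [← Finset.sum_neg_distrib]
      exact Finset.sum_congr rfl (fun i _ => (neg_sub _ _).symm)
    have key := hgood1 (fun i => (soloBlindTriRep (g i) (f i)).1)
      (fun i => (soloBlindTriRep (g i) (f i)).2) (soloBlindTriRep3 x y).1 (by
        simp only [soloBlind_triRep_val a b c hsum]
        rw [hval, hneg, ← neg_add, hdiff, neg_zero])
    have hf : f = g :=
      funext fun i => (soloBlind_triRep_eq_of_none (g i) (f i) (key.1 i).1 (key.1 i).2).symm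
    have hx : x = y := soloBlind_triRep3_eq_of_none x y key.2
    subst hf; subst hx; rfl

/-- **Conjecture T△ for `2d + 1` triangles (one simple), sharp form: `|H| ≥ 3^(d+1)`.** -/
theorem soloBlind_triangleDoubled_add_simple_card [Fintype H] (a b c : Fin d → H)
    (hsum : ∀ i, a i + b i + c i = 0) (a' b' c' : H) (hsum1 : a' + b' + c' = 0)
    (hgood1 : ∀ (s t : Fin d → Option (Fin 3)) (o : Option (Fin 3)),
      (∑ i, (soloBlindTriVal a b c i (s i) + soloBlindTriVal a b c i (t i))) + o.elim 0 ![a', b', c'] = 0 →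
        (∀ i, s i = none ∧ t i = none) ∧ o = none) :
    3 ^ (d + 1) ≤ Fintype.card H := by
  classical
  have h := Fintype.card_le_of_injective _
    (soloBlind_triangleDoubled_add_simple_injective a b c hsum a' b' c' hsum1 hgood1)
  simpa [Fintype.card_prod, Fintype.card_fun, Fintype.card_fin, pow_succ] using h

end TriangleSimpleOne

end Summit.MatrixMultiplication.MatrixMultiplication.Theorems
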